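import Summits.CriticalPhenomena.PercolationContinuityZ3.Theorems.Transplant.BoxProdZ2ConcClosure
import HarnessLib

/-!
# The (D) partial closure, SHARED-CHOICE form: the instance's choices as ONE function (`ChoiceFn`), the three residues as three
# INDEPENDENT statements about it (`RootHoldsFn`, `FaceHoldsFn`, `ReachHoldsFn`), and `thetaDropBoxProdZ2_of_choiceFn` — so that the root
# chain (D8), the faces and the probes of the `X □ ℤ²` instance land as three separate files by three seats (logistics only; refuter p5-g3
# 14:58Z: "pure logistics — no objection")

builds on p205010 (kernel theorem, internal audit signed; external expert review pending).
Status sentence (coordinator 2026-08-20T04:30Z): "θ(p_c) = 0 on ℤ^d, all d ≥ 2 — kernel-verified (Lean 4/Mathlib, standard axioms); internal adversarial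
audit SIGNED 2026-08-20 04:29Z; external expert review pending."
Lane `prim-bschramm-*`, seat `prim-bschramm-stmt` (gen 5); helper file (`--supports stmt-CriticalPhenomena-4575`).

`thetaDropBoxProdZ2_of_concG_residues` (p221792) asks for ONE statement `hres` whose quantifier prefix (`∃ V₀ δin m₀, ∀ msel M₀, ∃ S, ∀ q, ∃ C Λ, …`)
is SHARED by the three residues, so as stated it is proved by whoever finishes last.  Here the choices become data:
* `ConcConsts` — the handed-over p-free constants `Δ K₀ δ δ₂ δr` with their bounds;
* `ConcChoice κ X w p hT` — the instance's choices at `(X, w, p)`: `V₀`, `δin > 0`, `m₀`, the scale set `S msel M₀ ⊆ [M₀, ∞)`, and per running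
  parameter the planar cells `C msel M₀ q` and schedule `Λ msel M₀ q`, with `Λ.WF C ∧ K₀ ≤ C.K` whenever `AtQ` (the premises of step (B): inner
  sizes as produced by `exists_inputs_at_p`, `q ∈ [p/2, p]`, the inputs over `V₀ × S` at accuracy `δin` hold at `q`, `TubeSubcritical X q`);
  `ConcChoice.scheme` (= `concSchemeG X C w Λ q κ.δ`), `.faces` (= `faceDataCG X C w Λ`);
* `ConcChoice.RootHolds / FaceHolds / ReachHolds` — `∀ msel M₀ q, AtQ → RootOblT / FaceOblC / ReachOblC` at the chosen scheme;
* `ChoiceFn` — a choice for every admissible `(κ, X, w, p, hT)`; `RootHoldsFn 𝒞₀`, `FaceHoldsFn 𝒞₀`, `ReachHoldsFn 𝒞₀`;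
* **`thetaDropBoxProdZ2_of_choiceFn (𝒞₀) (hR : RootHoldsFn 𝒞₀) (hF : FaceHoldsFn 𝒞₀) (hRe : ReachHoldsFn 𝒞₀) : ThetaDropBoxProdZ2`**
  (and `bsConj4_boxProdZ2_of_choiceFn`).
USE: p3-g2 defines the concrete `concChoice₀ : ChoiceFn` (its CONSTANTS-PROD choices) in a small def file; then `RootHoldsFn concChoice₀` (root run,
p2-g2's `RootOblA` + `rootOblT_of_rootOblA`), `FaceHoldsFn concChoice₀`, `ReachHoldsFn concChoice₀` are three independent theorems.
[cite: KozmaNitzan2024, §4 Theorem 6 (pp. 25–31); §1 p. 2 (approach 1)]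
-/

noncomputable section

open MeasureTheory ProbabilityTheory
open scoped ENNReal Classical

namespace Summit.CriticalPhenomena.PercolationContinuityZ3.Theorems

namespace Transplant

namespace BoxProdZ2

open Literature.Probability.Percolation Literature.Probability.LatticeModels SimpleGraph KNCells
open Literature.Barriers.CriticalPhenomena (IsQuasiTransitive IsGraphAmenable countable_of_connected_of_locallyFinite)

/-! ## §1 Constants and choices as data -/

/-- **The constants handed to the instance** by the partial closure (all p-free): the degree bound `Δ`, the minimal number of stub levels
`K₀`, the chain accuracy `δ` (= the scheme's `δc`), the face-kit accuracy `δ₂`, the root-chain accuracies `δr n`. [this work] -/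
structure ConcConsts where
  /-- degree bound of `X` -/
  Δ : ℕ
  /-- minimal number of stub levels -/
  K₀ : ℕ
  /-- corridor-chain kit accuracy (= the scheme's `δc`) -/
  δ : ℝ
  /-- face-kit accuracy -/
  δ₂ : ℝ
  /-- root-chain kit accuracy for a chain of length `n + 1` -/
  δr : ℕ → ℝ
  hδ0 : 0 < δ
  hδ1 : δ ≤ 1
  hδ₂0 : 0 < δ₂
  hδ₂1 : δ₂ ≤ 1
  hδr : ∀ n, 0 < δr n ∧ δr n ≤ 1

variable {W : Type} [DecidableEq W] [Countable W]

/-- **The instance's choices at `(X, w, p)`** for the constants `κ`: fibre representatives, input accuracy, minimal inner size, the finite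
scale set (a function of the inner sizes / threshold produced by `exists_inputs_at_p`), and per running parameter the planar cells and the
fibre-radius schedule. [this work] -/
structure ConcChoice (κ : ConcConsts) (X : SimpleGraph W) [X.LocallyFinite] (w : W) (p : unitInterval) (hT : TubeSubcritical X p) where
  /-- fibre representatives -/
  V₀ : Finset W
  /-- input accuracy -/
  δin : ℝ
  /-- minimal inner size -/
  m₀ : ℕ
  /-- the finite set of planar scales, given the inner sizes and the threshold -/
  S : (W → ℕ) → ℕ → Finset ℕ
  /-- the planar cells at the running parameter -/
  C : (W → ℕ) → ℕ → unitInterval → PCells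
  /-- the fibre-radius schedule at the running parameter -/
  Λ : (W → ℕ) → ℕ → unitInterval → ConcRadiiG
  δin_pos : 0 < δin
  S_ge : ∀ (msel : W → ℕ) (M₀ : ℕ), (∀ τ ∈ V₀, m₀ ≤ msel τ ∧ msel τ < M₀) → ∀ M ∈ S msel M₀, M₀ ≤ M

namespace ConcChoice

variable {κ : ConcConsts} {X : SimpleGraph W} [X.LocallyFinite] {w : W} {p : unitInterval} {hT : TubeSubcritical X p}

/-- **The premises of step (B) at the running parameter `q`**: inner sizes / threshold as produced by `exists_inputs_at_p`, `q ∈ [p/2, p]`,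
the inputs over `V₀ × S` hold at `q` with accuracy `δin`, and `TubeSubcritical X q`. [this work] -/
def AtQ (𝒞 : ConcChoice κ X w p hT) (msel : W → ℕ) (M₀ : ℕ) (q : unitInterval) : Prop :=
  (∀ τ ∈ 𝒞.V₀, 𝒞.m₀ ≤ msel τ ∧ msel τ < M₀) ∧ (p : ℝ) / 2 ≤ q ∧ (q : ℝ) ≤ p ∧
    (∀ i ∈ inputIndex 𝒞.V₀ (𝒞.S msel M₀), 1 - 𝒞.δin < (bondPercolation (X □ zdGraph 2) q).real (inputEvent X hT 𝒞.V₀ msel i)) ∧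
    TubeSubcritical X q

/-- The chosen anchored-cells scheme at `q` (`concSchemeG` with `δc := κ.δ`). [this work] -/
abbrev scheme (𝒞 : ConcChoice κ X w p hT) (msel : W → ℕ) (M₀ : ℕ) (q : unitInterval) : KSchA (W × Site 2) ℕ :=
  concSchemeG X (𝒞.C msel M₀ q) w (𝒞.Λ msel M₀ q) q κ.δ

/-- The chosen face data at `q`. [this work] -/
abbrev faces (𝒞 : ConcChoice κ X w p hT) (msel : W → ℕ) (M₀ : ℕ) (q : unitInterval) : FaceData (W × Site 2) ℕ :=
  faceDataCG X (𝒞.C msel M₀ q) w (𝒞.Λ msel M₀ q)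

/-- **Well-formedness of the choices**: the schedule is well formed and the cells have `≥ K₀` stub levels whenever `AtQ`. [this work] -/
def WFHolds (𝒞 : ConcChoice κ X w p hT) : Prop :=
  ∀ (msel : W → ℕ) (M₀ : ℕ) (q : unitInterval), 𝒞.AtQ msel M₀ q → (𝒞.Λ msel M₀ q).WF (𝒞.C msel M₀ q) ∧ κ.K₀ ≤ (𝒞.C msel M₀ q).K

/-- **The root residue at the choices** (D8; KN §4 (32) at the root). [this work] -/
def RootHolds (𝒞 : ConcChoice κ X w p hT) : Prop :=
  ∀ (msel : W → ℕ) (M₀ : ℕ) (q : unitInterval), 𝒞.AtQ msel M₀ q → KSchA.RootOblT X (𝒞.scheme msel M₀ q) (κ.Δ + 4) κ.δr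

/-- **The face residue at the choices** (KN §4 p. 30, Step III). [this work] -/
def FaceHolds (𝒞 : ConcChoice κ X w p hT) : Prop :=
  ∀ (msel : W → ℕ) (M₀ : ℕ) (q : unitInterval), 𝒞.AtQ msel M₀ q →
    KSchA.FaceOblC X (𝒞.scheme msel M₀ q) (𝒞.faces msel M₀ q) (κ.Δ + 4) κ.δ₂

/-- **The corridor residue at the choices** (KN §4 p. 30, Step IV; Lemma 12). [this work] -/
def ReachHolds (𝒞 : ConcChoice κ X w p hT) : Prop :=
  ∀ (msel : W → ℕ) (M₀ : ℕ) (q : unitInterval), 𝒞.AtQ msel M₀ q →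
    KSchA.ReachOblC X (𝒞.scheme msel M₀ q) (𝒞.faces msel M₀ q) (κ.Δ + 4) κ.δ

end ConcChoice

/-- **A choice function**: the instance's choices for every handed constants `κ` and every admissible `(X, w, p, hT)` (degrees `≤ κ.Δ`,
connected, quasi-transitive, amenable, infinite; `0 < p < 1`; `TubeSubcritical X p`). [this work] -/
def ChoiceFn : Type 1 :=
  ∀ (κ : ConcConsts) {W : Type} [DecidableEq W] [Countable W] (X : SimpleGraph W) [X.LocallyFinite],
    (∀ v, X.degree v ≤ κ.Δ) → X.Connected → IsQuasiTransitive X → IsGraphAmenable X → Infinite W →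
      ∀ (w : W) (p : unitInterval), 0 < (p : ℝ) → (p : ℝ) < 1 → ∀ (hT : TubeSubcritical X p), ConcChoice κ X w p hT

/-- The well-formedness obligation of a choice function. [this work] -/
def WFHoldsFn (𝒞₀ : ChoiceFn) : Prop :=
  ∀ (κ : ConcConsts) {W : Type} [DecidableEq W] [Countable W] (X : SimpleGraph W) [X.LocallyFinite] (hΔ : ∀ v, X.degree v ≤ κ.Δ)
    (hc : X.Connected) (hqt : IsQuasiTransitive X) (ha : IsGraphAmenable X) (hinf : Infinite W) (w : W) (p : unitInterval)
    (hp0 : 0 < (p : ℝ)) (hp1 : (p : ℝ) < 1) (hT : TubeSubcritical X p), (𝒞₀ κ X hΔ hc hqt ha hinf w p hp0 hp1 hT).WFHolds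

/-- **The root obligation of a choice function** (D8; p2-g2's `RootOblA` + `rootOblT_of_rootOblA` serve; KN §4 p. 28). [this work] -/
def RootHoldsFn (𝒞₀ : ChoiceFn) : Prop :=
  ∀ (κ : ConcConsts) {W : Type} [DecidableEq W] [Countable W] (X : SimpleGraph W) [X.LocallyFinite] (hΔ : ∀ v, X.degree v ≤ κ.Δ)
    (hc : X.Connected) (hqt : IsQuasiTransitive X) (ha : IsGraphAmenable X) (hinf : Infinite W) (w : W) (p : unitInterval)
    (hp0 : 0 < (p : ℝ)) (hp1 : (p : ℝ) < 1) (hT : TubeSubcritical X p), (𝒞₀ κ X hΔ hc hqt ha hinf w p hp0 hp1 hT).RootHolds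

/-- **The face obligation of a choice function** (KN §4 p. 30, Step III). [this work] -/
def FaceHoldsFn (𝒞₀ : ChoiceFn) : Prop :=
  ∀ (κ : ConcConsts) {W : Type} [DecidableEq W] [Countable W] (X : SimpleGraph W) [X.LocallyFinite] (hΔ : ∀ v, X.degree v ≤ κ.Δ)
    (hc : X.Connected) (hqt : IsQuasiTransitive X) (ha : IsGraphAmenable X) (hinf : Infinite W) (w : W) (p : unitInterval)
    (hp0 : 0 < (p : ℝ)) (hp1 : (p : ℝ) < 1) (hT : TubeSubcritical X p), (𝒞₀ κ X hΔ hc hqt ha hinf w p hp0 hp1 hT).FaceHolds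

/-- **The corridor obligation of a choice function** (KN §4 p. 30, Step IV). [this work] -/
def ReachHoldsFn (𝒞₀ : ChoiceFn) : Prop :=
  ∀ (κ : ConcConsts) {W : Type} [DecidableEq W] [Countable W] (X : SimpleGraph W) [X.LocallyFinite] (hΔ : ∀ v, X.degree v ≤ κ.Δ)
    (hc : X.Connected) (hqt : IsQuasiTransitive X) (ha : IsGraphAmenable X) (hinf : Infinite W) (w : W) (p : unitInterval)
    (hp0 : 0 < (p : ℝ)) (hp1 : (p : ℝ) < 1) (hT : TubeSubcritical X p), (𝒞₀ κ X hΔ hc hqt ha hinf w p hp0 hp1 hT).ReachHolds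

/-! ## §2 The drop node from a choice function -/

/-- **THE (D) PARTIAL CLOSURE, shared-choice form**: a choice function whose choices are well formed and satisfy the root, face and corridor
obligations gives `ThetaDropBoxProdZ2` (through `thetaDropBoxProdZ2_of_concG_residues`). [cite: KozmaNitzan2024, §4 Theorem 6; §1 p. 2 (approach 1)] -/
theorem thetaDropBoxProdZ2_of_choiceFn (𝒞₀ : ChoiceFn) (hWF : WFHoldsFn 𝒞₀) (hR : RootHoldsFn 𝒞₀) (hF : FaceHoldsFn 𝒞₀)
    (hRe : ReachHoldsFn 𝒞₀) : ThetaDropBoxProdZ2 := by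
  refine thetaDropBoxProdZ2_of_concG_residues fun Δ K₀ δ δ₂ δr hδ0 hδ1 hδ₂0 hδ₂1 hδr {W} _ _ X _ hΔ hc hqt ha hinf w p hp0 hp1 hT => ?_
  set κ : ConcConsts := ⟨Δ, K₀, δ, δ₂, δr, hδ0, hδ1, hδ₂0, hδ₂1, hδr⟩ with hκ
  set 𝒞 := 𝒞₀ κ X hΔ hc hqt ha hinf w p hp0 hp1 hT with h𝒞
  refine ⟨𝒞.V₀, 𝒞.δin, 𝒞.m₀, 𝒞.δin_pos, fun msel M₀ hmsel => ⟨𝒞.S msel M₀, 𝒞.S_ge msel M₀ hmsel, fun q hq1 hq2 hin hTq => ?_⟩⟩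
  have hat : 𝒞.AtQ msel M₀ q := ⟨hmsel, hq1, hq2, hin, hTq⟩
  obtain ⟨hwf, hK⟩ := hWF κ X hΔ hc hqt ha hinf w p hp0 hp1 hT msel M₀ q hat
  exact ⟨𝒞.C msel M₀ q, 𝒞.Λ msel M₀ q, hwf, hK, hR κ X hΔ hc hqt ha hinf w p hp0 hp1 hT msel M₀ q hat,
    hF κ X hΔ hc hqt ha hinf w p hp0 hp1 hT msel M₀ q hat, hRe κ X hΔ hc hqt ha hinf w p hp0 hp1 hT msel M₀ q hat⟩

/-- **Hence `BSConj4_boxProdZ2` from a choice function** (lead's `bsConj4_boxProdZ2_of_dropNode`) — builds on p205010 (kernel theorem, internal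
audit signed; external expert review pending). [cite: BenjaminiSchramm1996, Conj. 4] [cite: KozmaNitzan2024, §1 p. 2 (approach 1)] -/
theorem bsConj4_boxProdZ2_of_choiceFn (𝒞₀ : ChoiceFn) (hWF : WFHoldsFn 𝒞₀) (hR : RootHoldsFn 𝒞₀) (hF : FaceHoldsFn 𝒞₀)
    (hRe : ReachHoldsFn 𝒞₀) : BSConj4_boxProdZ2 :=
  bsConj4_boxProdZ2_of_dropNode (thetaDropBoxProdZ2_of_choiceFn 𝒞₀ hWF hR hF hRe)

end BoxProdZ2

end Transplant

end Summit.CriticalPhenomena.PercolationContinuityZ3.Theorems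

end
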